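import Summits.BirchSwinnertonDyer.Rank1Residual.X11b.Three.HsiehCommonFrame
import Summits.BirchSwinnertonDyer.Rank1Residual.X11b.KummerTwistIntersectionPadic
import Summits.BirchSwinnertonDyer.Rank1Residual.X11b.UnrIntegersValuationRing
import Summits.BirchSwinnertonDyer.Rank1Residual.X11b.Three.LambdaSupplyTwistSupply
import Summits.BirchSwinnertonDyer.Rank1Residual.X11b.Three.LambdaSupplyRadical
import HarnessLib

/-!
# X11b @ `p = 3`, S28-a 'COMMON FRAME', part 2 of 2: the glue OF RECORD
# `hval → (K2) → (K2a) → HsiehCommonFrameAt₃ W → HsiehDescentAt₃ W`, every side input SUPPLIED from the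
# tree, and the end state `HsiehCommonFrameAt₃ W ↔ HsiehDescentAt₃ W`

HONEST FRAMING (cell `b2b-bsdres`, run/shared/lean/b2b/bsd-rank1-residual/, verbatim in every
file): the goal of the cell is to DELETE the COMBINATION-SHAPED residual classes of the
Birch–Swinnerton-Dyer formula for ALL analytic-rank `≤ 1` elliptic curves over `ℚ` — assembled
STRICTLY from published theorems — so that the rank-`≤ 1` remainder becomes exactly the
CONSTRUCTION-SHAPED classes, which are TYPED, NOT attempted. This is not "finishing BSD". Team N8/O2
(X11b at `3`: `3 ‖ N`, `r_an = 1`, `E[3]` irreducible): research route; nothing booked; NO label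
changes; O2 stays OPEN. THEOREMS ONLY (no definition, no fact, no `sorry`); fact debt `0`.

PROVENANCE: as part 1 (`Three/HsiehCommonFrame.lean`: the ONE `@[conjecture] def HsiehCommonFrameAt₃`,
§1–§3) — sub-target S28 (OWNERS R8-18 / R8-22 / R8-24 (iii) / R8-28 / R8-30 (c) / R8-32 / R8-34, lead
x11b3 GEN 7); TYPING OF RECORD = x11b3-r1 GEN 8 `S28-SKETCH.lean` v3 c293da618d8d8fa5 (r2 GEN 9 XS
cross-read PASS 31efb36efbfc8583, X4 OPTION (a)) → `S28-SKETCH-v4-READY.lean` a601c7d861544f3e (§6);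
FILING HAND seat `b2b-bsdres-x11b3-p3` (gen. 6): r1's declarations (statements AND proofs)
BYTE-IDENTICAL up to ONE syntactic change forced by the tree's lint (no `notation` in tree files): r1's
file-local notation `𝔎₃` is EXPANDED to its definiens `Subfield.closure ((unrIntegers 3 : Subring ℂ_[3]) :
Set ℂ_[3])` at each use (elaborated statements identical; in the prose below `𝔎₃` keeps that meaning),
split into two files only because of the tree's 400-line lint; r2 GEN 10 byte re-check
`gen10/S28a-RECHECK-r2.md` e153e2e156e08ef3 (tick transfers to v3 and v4; N7: §5 not filed). See part
1's module docstring for the DICTIONARY (`R₀`, `𝔎₃`, `F_λ`, (K1), `hval`, (K2), (K2a)) and the TYPING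
DECISIONS (T1)–(T5). Contents of THIS file:
* §4 THE GLUE OF RECORD (R8-24 (iii) / R8-28 / R8-32): (K1) PROVED (`inter_subset_unrIntegers_of_supplies`)
  from the ONE labelled infrastructure binder `hval` = (DISC) ∧ (U-c) (lit1 l.3829 (a) / p4 l.684
  wording VERBATIM) and the two NAMED theorem targets (K2), (K2a), in the SUBFIELD currency
  `𝔎₃ = Subfield.closure (unrIntegers 3)` so that multr1-p1's landed
  `R1.mem_subfield_padic_of_forall_mem_closure` (`X11b/KummerTwistIntersectionPadic.lean`, p263901)
  applies VERBATIM (ROAD DEFAULT, R8-30 (c)); and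
  `hsiehDescentAt₃_of_commonFrame : hval → (K2) → (K2a) → HsiehCommonFrameAt₃ W → HsiehDescentAt₃ W`;
* §5 (r1's courtesy lemma `exists_padicAlgCl_coe_eq_of_pow_eq_one`: a `3^a`-th root of unity of `ℂ₃` comes
  from `ℚ̄₃`, the bridge between p2's (K2-e) (`η : PadicAlgCl 3`) and `hK2` (`η : ℂ₃`)) is NOT FILED here: it is
  in the tree as x11b3-p2's `LambdaSupply.exists_padicAlgCl_coe_eq_of_pow_eq_one` (p266624; r2 N7);
* §6 (filing hand's plan, R8-34 (b); bytes r1's v4-READY) `hval` DISCHARGED BY IMPORT: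
  `fracUnr_discrete_and_valuationRing₃ : hval` from multr1-p1's `X11b/UnrIntegersValuationRing.lean`
  (p266190: `R1.exists_norm_eq_zpow_of_mem_fracUnr`, `R1.mem_unrIntegers_of_mem_fracUnr`), and the
  `hval`-FREE glue of record `hsiehDescentAt₃_of_commonFrame_of_supplies : (K2) → (K2a) →
  HsiehCommonFrameAt₃ W → HsiehDescentAt₃ W` — after which the glue's binders are exactly the two theorem
  targets in flight ((K2): x11b3-p2 `LambdaSupplyTwistFamily.lean` p265205 + `LambdaSupplyTwistOrbit.lean`
  p266140; (K2a): x11b3-p7, R8-33 (c)) plus the node;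
* §7 (filing hand, R8-38) BOTH TARGETS SUPPLIED from the tree (`LambdaSupply.twistSupply₃` p266624 =
  `hK2`, `Three.exists_admissible_radical` p266745 = `hK2a`): `hsiehDescentAt₃_of_hsiehCommonFrameAt₃ :
  HsiehCommonFrameAt₃ W → HsiehDescentAt₃ W` with NO side binder, and the end state
  **`hsiehCommonFrameAt₃_iff_hsiehDescentAt₃ : HsiehCommonFrameAt₃ W ↔ HsiehDescentAt₃ W`** (r2 N8) — the
  (W₃)-reading made EXACT; a reading, not a smaller target (H45).
WORDING OF RECORD (R8-18 / R8-28 / R8-34, H45): S28 RE-EXPRESSES (t) GIVEN printed (n1) + kernel field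
theory; the 'modulo (DISC)/(U-c)' clause is DISCHARGED in the kernel (§6); NOTHING SHRINKS — this is the
(W₃)-reading of the node of record `Three.HsiehDescentAt₃ W`; nothing asserted, nothing booked, no mark /
label / count moves; O2 OPEN; X11 ∧ r = 1 ∧ p = 3 CONSTRUCTION-SHAPED.
-/

noncomputable section

open scoped Classical

open WeierstrassCurve NumberField IsDedekindDomain Field PowerSeries
  Literature.NumberTheory.EllipticCurves Literature.NumberTheory.EllipticCurves.ModularForms
  Literature.NumberTheory.EllipticCurves.Rank1Residual
  Literature.NumberTheory.GaloisRepresentations Literature.NumberTheory.Automorphic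

namespace Summit.BirchSwinnertonDyer.Rank1Residual.X11b.Three

/-! ### §4 The glue OF RECORD (R8-24 (iii) / R8-28 / R8-32): (K1) from the labelled binder `hval` =
(DISC) ∧ (U-c) and the NAMED targets (K2), (K2a), in the SUBFIELD currency, via multr1-p1's landed
`R1.mem_subfield_padic_of_forall_mem_closure` VERBATIM (ROAD DEFAULT, R8-30 (c)); the binders ARE the
signatures of record -/

section Reduction

/-- `𝒪_{ℂ₃}` in norm currency (cf. `Dwork.mem_unitBall`). [folklore] -/
theorem norm_le_one_of_mem_padicComplexInt {x : ℂ_[3]} (hx : x ∈ PadicComplexInt 3) : ‖x‖ ≤ 1 := by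
  have h : x ∈ (PadicComplexInt 3).toSubring ↔ ‖x‖ ≤ 1 := by
    rw [ValuationSubring.mem_toSubring, PadicComplexInt, Valuation.mem_valuationSubring_iff,
      PadicComplex.norm_eq_norm, Valuation.norm_def]
    simp
  exact h.mp hx

/-- **(K1) ⟸ `hval` [(DISC) ∧ (U-c)] + (K2) + (K2a) — the twist intersection from ONE labelled
infrastructure binder and two NAMED theorem targets, by the landed Kummer lemma VERBATIM.** Binders:
* `hval` (R8-28 (a); lit1 l.3829 (a) / p4 l.684 wording, the two conjuncts VERBATIM) = (DISC) `‖x‖ ∈ 3^ℤ`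
  for `0 ≠ x ∈ 𝔎₃ = Subfield.closure (unrIntegers 3)` ∧ (U-c) `x ∈ 𝔎₃ → ‖x‖ ≤ 1 → x ∈ unrIntegers 3`:
  THEOREM-SHAPED, CFT-free, conjecture-free — a valuation-theory statement about `\widehat{ℚ₃^{ur}} ⊂ ℂ₃`
  (`unrIntegers 3` is a complete DVR with uniformiser `3` and `𝔎₃` its fraction field) not yet in
  Mathlib; discharged BY NAME when the tree theorems land (lit1's `UnrIntegersUnits.lean` (U), p4's
  `UNR-DISC-SCOPE.md`, R8-28 (b)). ROAD (R8-28 (c); DEFAULT by R8-30 (c)): multr1-p1's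
  `R1.mem_subfield_padic_of_forall_mem_closure` (`p ≠ 2`, any subfield `L ⊆ ℂ_p` with `‖L ∖ 0‖ ⊆ p^ℤ`,
  radical `x ^ p ^ a = u ∈ L ∖ 0` of ANY exponent, `η` over ALL `p^a`-th roots of unity, no case split;
  (h_ζ) is DERIVED from (DISC) inside it by `R1.pow_eq_one_imp_eq_one_of_norm_zpow`, the primitive
  `3^a`-th root by `IsAlgClosed ℂ_p`) — `hval` is in NORM currency and matches its `hL` verbatim.
  ALTERNATIVE ROAD (not taken): p4's `KummerRadical.adjoin_inf_adjoin_mul_eq_bot (K := 𝔎₃) (Ω := ℂ₃)`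
  (p264085) with (h_a), (h_ζ) from `KummerRadical.pow_three_ne_of_valuation_sub_one` /
  `eq_one_of_pow_three_eq_one` (p264420) under a `Valuation 𝔎₃ ℤᵐ⁰` with `v 3 = exp (−1)` — it needs
  the valuation AS DATA, a PURE radical with `v (a − 1) = exp (−1)` (S28-0 §3's re-basing done inside
  the glue) and the `k = 0` case apart, i.e. strictly more than (DISC).
* `hK2` = (K2) (S28-c, p2 GEN 4 `X11b/Three/LambdaSupplyTwistFamily.lean`; r2 N6: ONE assembly lemma with
  this signature VERBATIM) TWIST SUPPLY in the ∃-form the glue consumes: every admissible `(λ, r_λ)` and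
  every `η ∈ ℂ₃` with `η^{3^a} = 1` admit an admissible `(λ', r_λ')` with `r_λ'(γ) = η · r_λ(γ)` —
  assembled from p2's (K2-a) `twist_admissible` (action of `ε = (μ, r_μ)`) + (K2-e)
  `exists_admissible_twist_of_pow_eq_one` (an `ε` of `3`-power order through `Γ⁻` with `r_μ(γ) = η`,
  `η` lifted to `ℚ̄₃` by p2's `exists_padicAlgCl_coe_eq_of_pow_eq_one`) + multiplicativity of
  `avatarValueAt` — in the tree as ONE decl `LambdaSupply.twistSupply₃` = this signature VERBATIM, p266624;
* `hK2a` = (K2a) (= r2's (K3); owner S28-c, p7 candidate) RADICAL-VALUE SUPPLY: SOME admissible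
  `(λ₁, r₁)` has `r₁(γ)^{3^a} = u` with `0 ≠ u ∈ 𝔎₃` (in nature `u ∈ ℚ₃ ⊂ 𝔎₃`,
  `algebraMap_coe_padicInt_mem_unrIntegers`: the Frobenius values `ι'⁻¹(λ(ϖ_v))` satisfy
  `λ(ϖ_v)^{h_K·w} ∈ K ⊂ ℚ₃` (`3` split) and Frobenii are dense
  (`absoluteGaloisGroup.subgroup_eq_top_of_isClosed_of_frobenius_mem`, the lemma behind
  `eq_of_isPAdicAvatarOf` of `X11b/Three/LambdaSupplyTransport.lean`), so `r(σ)^{h_K w} ∈ ℚ₃` on `Γ_K`;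
  the prime-to-`3` part of the exponent is removed inside the principal units — GLOBAL, no local–global
  compatibility at `𝔭` (r2 X5: endorsed over the local route); existence of an admissible `λ₁` is S24-a
  `Three.lambdaSupplyAt₃`, p264661).
Proof: take `(λ₁, r₁, a, u)` by (K2a); for each `η` with `η^{3^a} = 1` twist by (K2), so
`x ∈ F_{λ'} = Subfield.closure (R₀ ∪ {η·r₁(γ)}) ≤ Subfield.closure (𝔎₃ ∪ {η·r₁(γ)})`
(`Subfield.closure_mono`); the Kummer lemma gives `x ∈ 𝔎₃`; `‖x‖ ≤ 1` (`x ∈ 𝒪_{ℂ₃}`) and (U-c) give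
`x ∈ R₀`. No closedness, no continuity (R8-32). [cite: Hsieh2014, Prop. 5.5 (arXiv:1112.1580 p. 23) (admissible twists λε)]
[cite: Lang2002, VI §9 (Kummer radicals)] -/
theorem inter_subset_unrIntegers_of_supplies
    (hval : (∀ x ∈ Subfield.closure ((unrIntegers 3 : Subring ℂ_[3]) : Set ℂ_[3]), x ≠ 0 →
        ∃ n : ℤ, ‖x‖ = (3 : ℝ) ^ n) ∧
      (∀ x ∈ Subfield.closure ((unrIntegers 3 : Subring ℂ_[3]) : Set ℂ_[3]), ‖x‖ ≤ 1 →
        x ∈ unrIntegers 3))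
    (hK2 : ∀ (ι' : PadicAlgCl 3 ≃+* ℂ) (K : Type) [Field K] [NumberField K] (κ : ZpExtension K 3)
      (γ : absoluteGaloisGroup K), IsImaginaryQuadratic K →
      ((Ideal.span {(3 : ℤ)}).primesOver (𝓞 K)).ncard = 2 → κ.IsAnticyclotomic → κ.IsTopGenerator γ →
      ∀ (lam : HeckeCharacter K) (rlam : FramedGaloisRep K (PadicAlgCl 3) 1),
        lam.IsUnitary → lam.HasInfinityType (fun _ ↦ (1 : ℤ)) (fun _ ↦ (-1 : ℤ)) →
        (∀ x : ideleGroup ℚ, lam (AdeleRing.ideleBaseChange ℚ K x) = 1) →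
        (∀ v : HeightOneSpectrum (𝓞 K), ((3 : ℕ) : 𝓞 K) ∉ v.asIdeal → lam.IsUnramifiedAt v) →
        IsPAdicAvatarOf ι' lam rlam → FactorsThroughZp κ rlam →
        ∀ (η : ℂ_[3]) (a : ℕ), η ^ 3 ^ a = 1 →
          ∃ (lam' : HeckeCharacter K) (rlam' : FramedGaloisRep K (PadicAlgCl 3) 1),
            lam'.IsUnitary ∧ lam'.HasInfinityType (fun _ ↦ (1 : ℤ)) (fun _ ↦ (-1 : ℤ)) ∧
            (∀ x : ideleGroup ℚ, lam' (AdeleRing.ideleBaseChange ℚ K x) = 1) ∧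
            (∀ v : HeightOneSpectrum (𝓞 K), ((3 : ℕ) : 𝓞 K) ∉ v.asIdeal → lam'.IsUnramifiedAt v) ∧
            IsPAdicAvatarOf ι' lam' rlam' ∧ FactorsThroughZp κ rlam' ∧
            avatarValueAt rlam' γ = η * avatarValueAt rlam γ)
    (hK2a : ∀ (ι' : PadicAlgCl 3 ≃+* ℂ) (K : Type) [Field K] [NumberField K] (κ : ZpExtension K 3)
      (γ : absoluteGaloisGroup K), IsImaginaryQuadratic K →
      ((Ideal.span {(3 : ℤ)}).primesOver (𝓞 K)).ncard = 2 → κ.IsAnticyclotomic → κ.IsTopGenerator γ →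
      ∃ (lam : HeckeCharacter K) (rlam : FramedGaloisRep K (PadicAlgCl 3) 1) (a : ℕ) (u : ℂ_[3]),
        lam.IsUnitary ∧ lam.HasInfinityType (fun _ ↦ (1 : ℤ)) (fun _ ↦ (-1 : ℤ)) ∧
        (∀ x : ideleGroup ℚ, lam (AdeleRing.ideleBaseChange ℚ K x) = 1) ∧
        (∀ v : HeightOneSpectrum (𝓞 K), ((3 : ℕ) : 𝓞 K) ∉ v.asIdeal → lam.IsUnramifiedAt v) ∧
        IsPAdicAvatarOf ι' lam rlam ∧ FactorsThroughZp κ rlam ∧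
        u ∈ Subfield.closure ((unrIntegers 3 : Subring ℂ_[3]) : Set ℂ_[3]) ∧ u ≠ 0 ∧
          avatarValueAt rlam γ ^ 3 ^ a = u) :
    ∀ (ι' : PadicAlgCl 3 ≃+* ℂ) (K : Type) [Field K] [NumberField K] (κ : ZpExtension K 3)
      (γ : absoluteGaloisGroup K), IsImaginaryQuadratic K →
      ((Ideal.span {(3 : ℤ)}).primesOver (𝓞 K)).ncard = 2 → κ.IsAnticyclotomic → κ.IsTopGenerator γ →
      ∀ x : ℂ_[3], x ∈ PadicComplexInt 3 →
      (∀ (lam : HeckeCharacter K) (rlam : FramedGaloisRep K (PadicAlgCl 3) 1),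
        lam.IsUnitary → lam.HasInfinityType (fun _ ↦ (1 : ℤ)) (fun _ ↦ (-1 : ℤ)) →
        (∀ y : ideleGroup ℚ, lam (AdeleRing.ideleBaseChange ℚ K y) = 1) →
        (∀ v : HeightOneSpectrum (𝓞 K), ((3 : ℕ) : 𝓞 K) ∉ v.asIdeal → lam.IsUnramifiedAt v) →
        IsPAdicAvatarOf ι' lam rlam → FactorsThroughZp κ rlam →
        x ∈ Subfield.closure ((unrIntegers 3 : Set ℂ_[3]) ∪ {avatarValueAt rlam γ})) →
      x ∈ unrIntegers 3 := by
  haveI : Fact (Nat.Prime 3) := ⟨Nat.prime_three⟩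
  intro ι' K _ _ κ γ hK h3 hκ hγ x hx1 hxF
  have hL : ∀ w ∈ Subfield.closure ((unrIntegers 3 : Subring ℂ_[3]) : Set ℂ_[3]), w ≠ 0 →
      ∃ n : ℤ, ‖w‖ = ((3 : ℕ) : ℝ) ^ n := fun w hw hw0 ↦ by
    simpa using hval.1 w hw hw0
  have hRK : (unrIntegers 3 : Set ℂ_[3]) ⊆
      (Subfield.closure ((unrIntegers 3 : Subring ℂ_[3]) : Set ℂ_[3]) : Set ℂ_[3]) := Subfield.subset_closure
  obtain ⟨lam₁, r₁, a, u, h₁, h₂, h₃, h₄, h₅, h₆, hu𝔎, hu0, hpow⟩ := hK2a ι' K κ γ hK h3 hκ hγ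
  refine hval.2 x ?_ (norm_le_one_of_mem_padicComplexInt hx1)
  refine R1.mem_subfield_padic_of_forall_mem_closure (p := 3) (by norm_num) _ hL hu𝔎 hu0 hpow
    fun η hη ↦ ?_
  obtain ⟨lam', r', h₁', h₂', h₃', h₄', h₅', h₆', hval'⟩ :=
    hK2 ι' K κ γ hK h3 hκ hγ lam₁ r₁ h₁ h₂ h₃ h₄ h₅ h₆ η a hη
  have hx := hxF lam' r' h₁' h₂' h₃' h₄' h₅' h₆'
  rw [hval'] at hx
  exact Subfield.closure_mono (Set.union_subset_union_left _ hRK) hx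

variable (W : WeierstrassCurve ℚ) [W.IsElliptic] [W.IsGloballyMinimal]

omit [W.IsElliptic] [W.IsGloballyMinimal] in
/-- **S28-a GLUE OF RECORD, COMPLETE AND KERNEL-CHECKED (R8-32 VERBATIM): `hval` [(DISC) ∧ (U-c)] →
(K2) → (K2a) → `HsiehCommonFrameAt₃ W` → `HsiehDescentAt₃ W`** (`inter_subset_unrIntegers_of_supplies`
then `hsiehDescentAt₃_of_commonFrame_of_inter`). `hval` is the ONE labelled infrastructure binder of
R8-28 (a) (like `hsup`: theorem-shaped, CFT-free, conjecture-free, discharged by name when the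
`unrIntegers` API lands); (K2), (K2a) are S28-c's theorem targets (p2 / p7); fact debt 0; the last
binder is the node. HONEST LINE (R8-28): S28 RE-EXPRESSES (t) GIVEN printed (n1) + kernel field
theory, 'modulo (DISC)/(U-c) for `R₀`, a valuation-theory statement about `\widehat{ℚ₃^{ur}}` not yet
in Mathlib'; NOTHING SHRINKS (H45): this is the (W₃)-reading of the node of record `HsiehDescentAt₃ W`.
[cite: Hsieh2014, Thm. 6.1 and its proof ¶1 (arXiv:1112.1580 p. 25) (defined over 𝒪_L, L ⊂ ℚ̄_p finite chosen per λ — the construction-level source of (W₃))] -/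
theorem hsiehDescentAt₃_of_commonFrame
    (hval : (∀ x ∈ Subfield.closure ((unrIntegers 3 : Subring ℂ_[3]) : Set ℂ_[3]), x ≠ 0 →
        ∃ n : ℤ, ‖x‖ = (3 : ℝ) ^ n) ∧
      (∀ x ∈ Subfield.closure ((unrIntegers 3 : Subring ℂ_[3]) : Set ℂ_[3]), ‖x‖ ≤ 1 →
        x ∈ unrIntegers 3))
    (hK2 : ∀ (ι' : PadicAlgCl 3 ≃+* ℂ) (K : Type) [Field K] [NumberField K] (κ : ZpExtension K 3)
      (γ : absoluteGaloisGroup K), IsImaginaryQuadratic K →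
      ((Ideal.span {(3 : ℤ)}).primesOver (𝓞 K)).ncard = 2 → κ.IsAnticyclotomic → κ.IsTopGenerator γ →
      ∀ (lam : HeckeCharacter K) (rlam : FramedGaloisRep K (PadicAlgCl 3) 1),
        lam.IsUnitary → lam.HasInfinityType (fun _ ↦ (1 : ℤ)) (fun _ ↦ (-1 : ℤ)) →
        (∀ x : ideleGroup ℚ, lam (AdeleRing.ideleBaseChange ℚ K x) = 1) →
        (∀ v : HeightOneSpectrum (𝓞 K), ((3 : ℕ) : 𝓞 K) ∉ v.asIdeal → lam.IsUnramifiedAt v) →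
        IsPAdicAvatarOf ι' lam rlam → FactorsThroughZp κ rlam →
        ∀ (η : ℂ_[3]) (a : ℕ), η ^ 3 ^ a = 1 →
          ∃ (lam' : HeckeCharacter K) (rlam' : FramedGaloisRep K (PadicAlgCl 3) 1),
            lam'.IsUnitary ∧ lam'.HasInfinityType (fun _ ↦ (1 : ℤ)) (fun _ ↦ (-1 : ℤ)) ∧
            (∀ x : ideleGroup ℚ, lam' (AdeleRing.ideleBaseChange ℚ K x) = 1) ∧
            (∀ v : HeightOneSpectrum (𝓞 K), ((3 : ℕ) : 𝓞 K) ∉ v.asIdeal → lam'.IsUnramifiedAt v) ∧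
            IsPAdicAvatarOf ι' lam' rlam' ∧ FactorsThroughZp κ rlam' ∧
            avatarValueAt rlam' γ = η * avatarValueAt rlam γ)
    (hK2a : ∀ (ι' : PadicAlgCl 3 ≃+* ℂ) (K : Type) [Field K] [NumberField K] (κ : ZpExtension K 3)
      (γ : absoluteGaloisGroup K), IsImaginaryQuadratic K →
      ((Ideal.span {(3 : ℤ)}).primesOver (𝓞 K)).ncard = 2 → κ.IsAnticyclotomic → κ.IsTopGenerator γ →
      ∃ (lam : HeckeCharacter K) (rlam : FramedGaloisRep K (PadicAlgCl 3) 1) (a : ℕ) (u : ℂ_[3]),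
        lam.IsUnitary ∧ lam.HasInfinityType (fun _ ↦ (1 : ℤ)) (fun _ ↦ (-1 : ℤ)) ∧
        (∀ x : ideleGroup ℚ, lam (AdeleRing.ideleBaseChange ℚ K x) = 1) ∧
        (∀ v : HeightOneSpectrum (𝓞 K), ((3 : ℕ) : 𝓞 K) ∉ v.asIdeal → lam.IsUnramifiedAt v) ∧
        IsPAdicAvatarOf ι' lam rlam ∧ FactorsThroughZp κ rlam ∧
        u ∈ Subfield.closure ((unrIntegers 3 : Subring ℂ_[3]) : Set ℂ_[3]) ∧ u ≠ 0 ∧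
          avatarValueAt rlam γ ^ 3 ^ a = u)
    (hcf : HsiehCommonFrameAt₃ W) : HsiehDescentAt₃ W :=
  hsiehDescentAt₃_of_commonFrame_of_inter W (inter_subset_unrIntegers_of_supplies hval hK2 hK2a) hcf

end Reduction

/-! ### §6 (APPENDED per p3's filing plan INBOX l.3988 / R8-34 (b)) `hval` discharged by import and the
`hval`-free glue — ADDITIONS ONLY, no v3 declaration touched -/

section Discharge

/-- **(DISC) ∧ (U-c) for `𝔎₃ = Frac R₀ ⊂ ℂ₃` — the `hval` binder of v3, now a THEOREM by import**
(multr1-p1 Part II `X11b/UnrIntegersValuationRing.lean`: `R1.exists_norm_eq_zpow_of_mem_fracUnr`,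
`R1.mem_unrIntegers_of_mem_fracUnr`; the cast `((3 : ℕ) : ℝ) ^ n = (3 : ℝ) ^ n` is definitional). [folklore] -/
theorem fracUnr_discrete_and_valuationRing₃ :
    (∀ x ∈ Subfield.closure ((unrIntegers 3 : Subring ℂ_[3]) : Set ℂ_[3]), x ≠ 0 →
        ∃ n : ℤ, ‖x‖ = (3 : ℝ) ^ n) ∧
      (∀ x ∈ Subfield.closure ((unrIntegers 3 : Subring ℂ_[3]) : Set ℂ_[3]), ‖x‖ ≤ 1 →
        x ∈ unrIntegers 3) :=
  ⟨fun _ hx hx0 ↦ R1.exists_norm_eq_zpow_of_mem_fracUnr hx hx0,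
    fun _ hx hx1 ↦ R1.mem_unrIntegers_of_mem_fracUnr hx hx1⟩

variable (W : WeierstrassCurve ℚ) [W.IsElliptic] [W.IsGloballyMinimal]

omit [W.IsElliptic] [W.IsGloballyMinimal] in
/-- **S28-a `hval`-FREE GLUE (v4 = v3 + §6, R8-34 (b)): (K2) → (K2a) → `HsiehCommonFrameAt₃ W` → `HsiehDescentAt₃ W`**
— exactly the two S28-c THEOREM TARGETS in flight ((K2) p2 `LambdaSupplyTwistFamily` parts 1–2 as ONE
lemma with this `hK2` signature verbatim; (K2a) = r2's (K3), p7) plus the node; `hval` is consumed from the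
tree (`fracUnr_discrete_and_valuationRing₃`). Binder types of `hK2` / `hK2a` are byte-identical to v3. HONEST LINE (R8-28 / R8-34,
police H45): S28 RE-EXPRESSES (t) GIVEN printed (n1) + kernel field theory — the 'modulo (DISC)/(U-c)'
clause is now DISCHARGED in the kernel; NOTHING SHRINKS: this is the (W₃)-reading of the node of record
`HsiehDescentAt₃ W`. [cite: Hsieh2014, Thm. 6.1 and its proof ¶1 (arXiv:1112.1580 p. 25)] -/
theorem hsiehDescentAt₃_of_commonFrame_of_supplies
    (hK2 : ∀ (ι' : PadicAlgCl 3 ≃+* ℂ) (K : Type) [Field K] [NumberField K] (κ : ZpExtension K 3)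
      (γ : absoluteGaloisGroup K), IsImaginaryQuadratic K →
      ((Ideal.span {(3 : ℤ)}).primesOver (𝓞 K)).ncard = 2 → κ.IsAnticyclotomic → κ.IsTopGenerator γ →
      ∀ (lam : HeckeCharacter K) (rlam : FramedGaloisRep K (PadicAlgCl 3) 1),
        lam.IsUnitary → lam.HasInfinityType (fun _ ↦ (1 : ℤ)) (fun _ ↦ (-1 : ℤ)) →
        (∀ x : ideleGroup ℚ, lam (AdeleRing.ideleBaseChange ℚ K x) = 1) →
        (∀ v : HeightOneSpectrum (𝓞 K), ((3 : ℕ) : 𝓞 K) ∉ v.asIdeal → lam.IsUnramifiedAt v) →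
        IsPAdicAvatarOf ι' lam rlam → FactorsThroughZp κ rlam →
        ∀ (η : ℂ_[3]) (a : ℕ), η ^ 3 ^ a = 1 →
          ∃ (lam' : HeckeCharacter K) (rlam' : FramedGaloisRep K (PadicAlgCl 3) 1),
            lam'.IsUnitary ∧ lam'.HasInfinityType (fun _ ↦ (1 : ℤ)) (fun _ ↦ (-1 : ℤ)) ∧
            (∀ x : ideleGroup ℚ, lam' (AdeleRing.ideleBaseChange ℚ K x) = 1) ∧
            (∀ v : HeightOneSpectrum (𝓞 K), ((3 : ℕ) : 𝓞 K) ∉ v.asIdeal → lam'.IsUnramifiedAt v) ∧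
            IsPAdicAvatarOf ι' lam' rlam' ∧ FactorsThroughZp κ rlam' ∧
            avatarValueAt rlam' γ = η * avatarValueAt rlam γ)
    (hK2a : ∀ (ι' : PadicAlgCl 3 ≃+* ℂ) (K : Type) [Field K] [NumberField K] (κ : ZpExtension K 3)
      (γ : absoluteGaloisGroup K), IsImaginaryQuadratic K →
      ((Ideal.span {(3 : ℤ)}).primesOver (𝓞 K)).ncard = 2 → κ.IsAnticyclotomic → κ.IsTopGenerator γ →
      ∃ (lam : HeckeCharacter K) (rlam : FramedGaloisRep K (PadicAlgCl 3) 1) (a : ℕ) (u : ℂ_[3]),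
        lam.IsUnitary ∧ lam.HasInfinityType (fun _ ↦ (1 : ℤ)) (fun _ ↦ (-1 : ℤ)) ∧
        (∀ x : ideleGroup ℚ, lam (AdeleRing.ideleBaseChange ℚ K x) = 1) ∧
        (∀ v : HeightOneSpectrum (𝓞 K), ((3 : ℕ) : 𝓞 K) ∉ v.asIdeal → lam.IsUnramifiedAt v) ∧
        IsPAdicAvatarOf ι' lam rlam ∧ FactorsThroughZp κ rlam ∧
        u ∈ Subfield.closure ((unrIntegers 3 : Subring ℂ_[3]) : Set ℂ_[3]) ∧ u ≠ 0 ∧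
          avatarValueAt rlam γ ^ 3 ^ a = u)
    (hcf : HsiehCommonFrameAt₃ W) : HsiehDescentAt₃ W :=
  hsiehDescentAt₃_of_commonFrame W fracUnr_discrete_and_valuationRing₃ hK2 hK2a hcf

end Discharge

/-! ### §7 (filing hand, R8-38) EVERY side input SUPPLIED from the tree: the glue with NO side binder,
and the (W₃)-reading made exact — `HsiehCommonFrameAt₃ W ↔ HsiehDescentAt₃ W` -/

section Supplied

variable (W : WeierstrassCurve ℚ) [W.IsElliptic] [W.IsGloballyMinimal]

omit [W.IsElliptic] [W.IsGloballyMinimal] in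
/-- **S28 glue with NO side binder: `HsiehCommonFrameAt₃ W → HsiehDescentAt₃ W`** —
`hsiehDescentAt₃_of_commonFrame_of_supplies` (§6) with (K2) `:=` x11b3-p2's `LambdaSupply.twistSupply₃`
(`Three/LambdaSupplyTwistSupply.lean`, p266624; statement = `hK2` VERBATIM, r2 N6) and (K2a) `:=`
x11b3-p7's `Three.exists_admissible_radical` (`Three/LambdaSupplyRadical.lean`, p266745; statement =
`hK2a` VERBATIM with `𝔎₃` unfolded, r2 GEN 10 §3). Lead R8-38: every side input of the S28 glue is a
THEOREM. CONDITIONAL only on the node `HsiehCommonFrameAt₃ W`; nothing asserted, nothing booked; O2 OPEN.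
[cite: Hsieh2014, Prop. 5.5 and Thm. 6.1 proof ¶1 (arXiv:1112.1580 pp. 23, 25) (admissible twists; construction over 𝒪_L per λ)] -/
theorem hsiehDescentAt₃_of_hsiehCommonFrameAt₃ (hcf : HsiehCommonFrameAt₃ W) : HsiehDescentAt₃ W :=
  hsiehDescentAt₃_of_commonFrame_of_supplies W LambdaSupply.twistSupply₃ exists_admissible_radical hcf

omit [W.IsElliptic] [W.IsGloballyMinimal] in
/-- **The (W₃)-reading IS the node, in the kernel: `HsiehCommonFrameAt₃ W ↔ HsiehDescentAt₃ W`**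
(`⇒` the supplied glue above; `⇐` the LOSSLESS converse `hsiehCommonFrameAt₃_of_descent` of part 1) — r2
GEN 10 N8's end state. WORDING OF RECORD (R8-18 / R8-38, H45): a READING made exact, NOT a smaller
target — S28 RE-EXPRESSES (t); `Three.HsiehDescentAt₃ W` is the node of record and is UNCHANGED; both
sides stay `@[conjecture]` nodes, UNPRINTED as statements at `3 ∣ N`, TYPED, not attempted; NOTHING
SHRINKS; nothing booked; no mark / label / count moves. (With x11b3-p7's
`hsiehFrameResidualAt₃_iff_hsiehDescentAt₃`, p265366, all three typed residuals at `3 ‖ N` —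
`HsiehFrameResidualAt₃ W`, `HsiehDescentAt₃ W`, `HsiehCommonFrameAt₃ W` — are now kernel-equivalent.)
[cite: Hsieh2014, Thm. 1 (arXiv:1112.1580 pp. 3–4) and Thm. 6.1 proof ¶1 (p. 25)] -/
theorem hsiehCommonFrameAt₃_iff_hsiehDescentAt₃ : HsiehCommonFrameAt₃ W ↔ HsiehDescentAt₃ W :=
  ⟨hsiehDescentAt₃_of_hsiehCommonFrameAt₃ W, hsiehCommonFrameAt₃_of_descent W⟩

end Supplied

end Summit.BirchSwinnertonDyer.Rank1Residual.X11b.Three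

end
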